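import Mathlib
import Summits.Ventures.PercRepro2.Harris
import Summits.Ventures.PercRepro2.BasePrime
import Summits.Ventures.PercRepro2.LocRows
import Summits.Ventures.PercRepro2.SwRow
import Summits.Ventures.PercRepro2.SwOutCube
import Summits.Ventures.PercRepro2.SwOutMixedCubeFarDefs
import Summits.Ventures.PercRepro2.SwOutBigBlockDefs

/-!
# The abstract big-block lemma: the cube minus its leaking points is TWO cubes (blind cell
PercRepro2, night-4 g17, 2026-08-27; proofs/NIGHT4-G17.md §4″–§4‴)

Vocabulary in `SwOutBigBlockDefs`: the raw cube `Pt ι κ` of colour classes around a mixed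
one-sided point `(s, a, uP, e, f)`, the red / blue edge sets `ER` / `EB`, the leaking points `Leak`,
the canonical points `C0 = {uP = e}` and the escaping points `D = {s = const e, uP = !e}` with their
embedded cubes `canon` and `esc`, and the property `G4` of the conditioning set.

**Theorem** `bigBlock_card_le`: for every lower set `Q` of the raw cube satisfying `G4` and every
up-set `𝓔` of atom sets, the non-leaking part of `Q` satisfies the rigid counting inequality.
Proof: a count over the non-leaking points splits into the canonical and the escaping points
(`card_split`), each is a count over its cube (`card_canon`, `card_esc`), and on each cube `Q`
pulls back to a lower set, the red set is monotone and the blue set is the red set of the flipped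
point — the cube principle `card_inter_le_of_cube` twice (`card_canon_le`, `card_esc_le`).
-/

namespace Summit.Ventures.PercRepro2

namespace BigBlock

open scoped Classical

variable {ι κ : Type*} [Fintype ι] [DecidableEq ι] [Fintype κ] [DecidableEq κ]

section Counting

variable (Q : Set (Pt ι κ)) (𝓔 : Set (Set (Atom ι κ)))

/-- A count over the non-leaking points splits into the canonical and the escaping points. -/
lemma card_split (R : Pt ι κ → Prop) :
    (Finset.univ.filter fun p => p ∈ Q ∧ ¬ Leak p ∧ R p).card =
      (Finset.univ.filter fun p => C0 p ∧ (p ∈ Q ∧ R p)).card +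
        (Finset.univ.filter fun p => D p ∧ (p ∈ Q ∧ R p)).card := by
  rw [← Finset.card_union_of_disjoint]
  · congr 1
    ext p
    simp only [Finset.mem_filter, Finset.mem_univ, true_and, Finset.mem_union, not_leak_iff]
    constructor
    · rintro ⟨hQ, hCD, hR⟩
      rcases hCD with h | h
      · exact Or.inl ⟨h, hQ, hR⟩
      · exact Or.inr ⟨h, hQ, hR⟩
    · rintro (⟨h, hQ, hR⟩ | ⟨h, hQ, hR⟩)
      · exact ⟨hQ, Or.inl h, hR⟩
      · exact ⟨hQ, Or.inr h, hR⟩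
  · rw [Finset.disjoint_left]
    intro p hp hp'
    simp only [Finset.mem_filter, Finset.mem_univ, true_and] at hp hp'
    exact not_C0_and_D p ⟨hp.1, hp'.1⟩

/-- A count over the canonical points is a count over the cube `Config (ι ⊕ (Fin 2 ⊕ κ))`. -/
lemma card_canon (R : Pt ι κ → Prop) :
    (Finset.univ.filter fun p => C0 p ∧ R p).card =
      (Finset.univ.filter fun x : Config (ι ⊕ (Fin 2 ⊕ κ)) => R (canon x)).card := by
  have : (Finset.univ.filter fun p => C0 p ∧ R p) =
      (Finset.univ.filter fun x : Config (ι ⊕ (Fin 2 ⊕ κ)) => R (canon x)).image canon := by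
    ext p
    simp only [Finset.mem_filter, Finset.mem_univ, true_and, Finset.mem_image]
    constructor
    · rintro ⟨hC, hR⟩
      obtain ⟨x, rfl⟩ := (canon_range p).1 hC
      exact ⟨x, hR, rfl⟩
    · rintro ⟨x, hR, rfl⟩
      exact ⟨(canon_range _).2 ⟨x, rfl⟩, hR⟩
  rw [this, Finset.card_image_of_injective _ canon_injective]

/-- A count over the escaping points is a count over the cube `Config (Fin 2 ⊕ κ)`. -/
lemma card_esc (R : Pt ι κ → Prop) :
    (Finset.univ.filter fun p => D p ∧ R p).card =
      (Finset.univ.filter fun y : Config (Fin 2 ⊕ κ) => R (esc y)).card := by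
  have : (Finset.univ.filter fun p => D p ∧ R p) =
      (Finset.univ.filter fun y : Config (Fin 2 ⊕ κ) => R (esc y)).image esc := by
    ext p
    simp only [Finset.mem_filter, Finset.mem_univ, true_and, Finset.mem_image]
    constructor
    · rintro ⟨hD, hR⟩
      obtain ⟨y, rfl⟩ := (esc_range p).1 hD
      exact ⟨y, hR, rfl⟩
    · rintro ⟨y, hR, rfl⟩
      exact ⟨(esc_range _).2 ⟨y, rfl⟩, hR⟩
  rw [this, Finset.card_image_of_injective _ esc_injective]

variable {Q 𝓔} (hQ : IsLowerSet Q) (h𝓔 : IsUpperSet 𝓔)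
include hQ h𝓔

/-- **The canonical cube satisfies the rigid inequality** (the cube principle). -/
theorem card_canon_le :
    (Finset.univ.filter fun x : Config (ι ⊕ (Fin 2 ⊕ κ)) => canon x ∈ Q ∧ ER (canon x) ∈ 𝓔).card ≤
      (Finset.univ.filter fun x : Config (ι ⊕ (Fin 2 ⊕ κ)) =>
        canon x ∈ Q ∧ EB (canon x) ∈ 𝓔).card := by
  have hEv : IsLowerSet {x : Config (ι ⊕ (Fin 2 ⊕ κ)) | canon x ∈ Q} := by
    intro x y hle hx
    exact hQ (canon_mono hle) hx
  have hA : IsUpperSet {x : Config (ι ⊕ (Fin 2 ⊕ κ)) | ER (canon x) ∈ 𝓔} := by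
    intro x y hle hx
    exact h𝓔 (ER_mono (canon_mono hle)) hx
  have hB : IsLowerSet {x : Config (ι ⊕ (Fin 2 ⊕ κ)) | EB (canon x) ∈ 𝓔} := by
    intro x y hle hx
    simp only [Set.mem_setOf_eq, EB, flipPt_canon] at hx ⊢
    exact h𝓔 (ER_mono (canon_mono (MixedCube.flipAll_le_flipAll' hle))) hx
  have hAB : flipAll ⁻¹' {x : Config (ι ⊕ (Fin 2 ⊕ κ)) | EB (canon x) ∈ 𝓔} =
      {x : Config (ι ⊕ (Fin 2 ⊕ κ)) | ER (canon x) ∈ 𝓔} := by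
    ext x
    simp only [Set.mem_preimage, Set.mem_setOf_eq, EB, flipPt_canon, flipAll_involutive x]
  have key := LocRows.card_inter_le_of_cube hEv hA hB hAB
  convert key using 2 <;> apply Finset.filter_congr <;> intro x _ <;>
    simp only [Set.mem_inter_iff, Set.mem_setOf_eq]

omit [Fintype ι] [DecidableEq ι] in
/-- **The escaping cube satisfies the rigid inequality** (the cube principle, under `G4`). -/
theorem card_esc_le (hG : G4 Q) :
    (Finset.univ.filter fun y : Config (Fin 2 ⊕ κ) => esc y ∈ Q ∧ ER (esc y) ∈ 𝓔).card ≤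
      (Finset.univ.filter fun y : Config (Fin 2 ⊕ κ) => esc y ∈ Q ∧ EB (esc y) ∈ 𝓔).card := by
  have hEv := esc_preimage_isLowerSet hQ hG
  have hA : IsUpperSet {y : Config (Fin 2 ⊕ κ) | ER (esc y) ∈ 𝓔} := by
    intro y y' hle hy
    exact h𝓔 (ER_esc_mono hle) hy
  have hB : IsLowerSet {y : Config (Fin 2 ⊕ κ) | EB (esc y) ∈ 𝓔} := by
    intro y y' hle hy
    simp only [Set.mem_setOf_eq, EB, flipPt_esc] at hy ⊢
    exact h𝓔 (ER_esc_mono (MixedCube.flipAll_le_flipAll' hle)) hy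
  have hAB : flipAll ⁻¹' {y : Config (Fin 2 ⊕ κ) | EB (esc y) ∈ 𝓔} =
      {y : Config (Fin 2 ⊕ κ) | ER (esc y) ∈ 𝓔} := by
    ext y
    simp only [Set.mem_preimage, Set.mem_setOf_eq, EB, flipPt_esc, flipAll_involutive y]
  have key := LocRows.card_inter_le_of_cube hEv hA hB hAB
  convert key using 2 <;> apply Finset.filter_congr <;> intro y _ <;>
    simp only [Set.mem_inter_iff, Set.mem_setOf_eq]

/-- **THE ABSTRACT BIG-BLOCK LEMMA**: for every lower set `Q` of the raw cube with `G4` and every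
up-set `𝓔` of atom sets, the non-leaking part of `Q` satisfies the rigid counting inequality. -/
theorem bigBlock_card_le (hG : G4 Q) :
    (Finset.univ.filter fun p : Pt ι κ => p ∈ Q ∧ ¬ Leak p ∧ ER p ∈ 𝓔).card ≤
      (Finset.univ.filter fun p : Pt ι κ => p ∈ Q ∧ ¬ Leak p ∧ EB p ∈ 𝓔).card := by
  have e1 := card_split Q (fun p => ER p ∈ 𝓔)
  have e2 := card_split Q (fun p => EB p ∈ 𝓔)
  beta_reduce at e1 e2
  -- the four block counts as cube counts (the decidability instances are reconciled by `convert`)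
  have c1 : (Finset.univ.filter fun p : Pt ι κ => C0 p ∧ (p ∈ Q ∧ ER p ∈ 𝓔)).card =
      (Finset.univ.filter fun x : Config (ι ⊕ (Fin 2 ⊕ κ)) =>
        canon x ∈ Q ∧ ER (canon x) ∈ 𝓔).card := by
    convert card_canon (ι := ι) (κ := κ) (fun p => p ∈ Q ∧ ER p ∈ 𝓔) using 3
  have c2 : (Finset.univ.filter fun p : Pt ι κ => C0 p ∧ (p ∈ Q ∧ EB p ∈ 𝓔)).card =
      (Finset.univ.filter fun x : Config (ι ⊕ (Fin 2 ⊕ κ)) =>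
        canon x ∈ Q ∧ EB (canon x) ∈ 𝓔).card := by
    convert card_canon (ι := ι) (κ := κ) (fun p => p ∈ Q ∧ EB p ∈ 𝓔) using 3
  have d1 : (Finset.univ.filter fun p : Pt ι κ => D p ∧ (p ∈ Q ∧ ER p ∈ 𝓔)).card =
      (Finset.univ.filter fun y : Config (Fin 2 ⊕ κ) => esc y ∈ Q ∧ ER (esc y) ∈ 𝓔).card := by
    convert card_esc (ι := ι) (κ := κ) (fun p => p ∈ Q ∧ ER p ∈ 𝓔) using 3
  have d2 : (Finset.univ.filter fun p : Pt ι κ => D p ∧ (p ∈ Q ∧ EB p ∈ 𝓔)).card =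
      (Finset.univ.filter fun y : Config (Fin 2 ⊕ κ) => esc y ∈ Q ∧ EB (esc y) ∈ 𝓔).card := by
    convert card_esc (ι := ι) (κ := κ) (fun p => p ∈ Q ∧ EB p ∈ 𝓔) using 3
  rw [e1, e2, c1, c2, d1, d2]
  exact add_le_add (card_canon_le hQ h𝓔) (card_esc_le hQ h𝓔 hG)

end Counting

end BigBlock

end Summit.Ventures.PercRepro2
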